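import Literature.AlgebraicGeometry.Resolution.JacobianRegularLocus
import Literature.AlgebraicGeometry.Resolution.RegularParameterQuotient
import Summits.ResolutionOfSingularities.ResolutionOfSingularities.Theorems.FrobeniusLadderFInjectiveMacaulayficationCIFedderAtMaximalIdeal
import Summits.ResolutionOfSingularities.ResolutionOfSingularities.Theorems.FrobeniusLadderFInjectiveMacaulayficationFiClauseOfRegular
import Mathlib.RingTheory.RegularLocalRing.Polynomial
import Mathlib.Algebra.MvPolynomial.PDeriv
import HarnessLib

/-!
# (G4ᶜⁱ-reg) The Jacobian criterion for complete intersections at an arbitrary prime, with the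
# expected dimension, and the chart-uniform Jacobian certificate

Support file for crux stmt-ResolutionOfSingularities-15315 (`FrobeniusLadder.FInjectiveMacaulayfication`), chain w45a, seat
res-L1-w45a-stub-6 (res-D-pv-018, D→L convert), file 7 of the CI-CN engine (idea-1 card 4; the algebraic core of
`Sketch-L1-idea-1.lean` r4 §9 (G4ᶜⁱ-reg) `ciSmoothChartRegular`, the KHOVANSKII case: the specimens T₁₁⁺ / T⁽⁴⁾⁺ have all
realisable initial complete intersections EMPTY or SMOOTH on the torus, K-T4). [OURS · L1 W4.5a] — NOT a statement of the
manuscript [claim: Hironaka2017]; AI-written, weaker than expert review.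

The tree's `…HypersurfaceRegular.lean` certifies regularity of `(k[y]/(g))_Q` from `∂g/∂yᵢ ∉ P` (Matsumura Thm. 30.4 (ii) with
`r = 1`). ONE EMBEDDING CODIMENSION UP, the height hypothesis of Thm. 30.4 (ii) (`ht (f)R_P = r`) is NOT needed for the ideal
`(f₁, …, f_r)` itself: `det(Dᵢ fⱼ) ∉ P` makes the `fⱼ/1` regular parameters of `R_P` (the mechanism of 30.4 (ii),
`forall_mem_of_sum_mul_mem_sq`), and Matsumura Thm. 14.2 (`RegularParameters.isRegularLocalRing_quotient_span_range`) gives BOTH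
regularity of `R_P/(f)R_P` AND its dimension `dim R_P − r` — the expected-dimension binder of `CIFedderAtMaximalIdeal` /
`CIChartClause` for free.

* §1 `forall_mem_maximalIdeal_of_det_not_mem` (any `R`, prime `P`, `Dᵢ ∈ Der_ℤ(R)`, `fⱼ ∈ P`, `det(Dᵢ fⱼ) ∉ P` ⇒ the `fⱼ/1`
  are independent modulo `𝔪²` in `R_P`), `isRegularLocalRing_quotient_of_det_not_mem` (`R_P` regular ⇒ `R_P/(f)` regular of
  dimension `dim R_P − r`), `isRegularLocalRing_stalk_of_det_not_mem` (the same for the local ring `(R/(f))_Q`, `Q ∩ R = P`).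
* §2 `S = k[y₀, …, y_{n-1}]`: `ci_clause_of_det_not_mem` — `(S/(f))_Q` is a regular local ring, a domain, satisfies the per-stalk
  clause of the crux (`FiClauseOfRegular.stub_fiClauseOfRegular`), and `dim (S/(f))_Q + r = dim S_P`; `…_of_isMaximal`: `= n`.
* §3 `ci_clause_of_jacobianCertificate` — the CHART-UNIFORM form a CI-CN chart certificate consumes: a Bezout identity
  `1 ∈ (f) + B + (the r×r coordinate minors μ₁, …, μ_t)` certifies regularity + clause + expected dimension at EVERY prime of
  `S/(f)` containing `B` (e.g. `B` = the exceptional coordinates: all points over the origin at once).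

No definitions, no named facts; glue. [folklore; cite: Matsumura1987, Thm. 30.4 (ii) and Thm. 14.2]
-/

-- single-problem summit: the doubled namespace component is forced
set_option linter.dupNamespace false

noncomputable section

namespace Summit.ResolutionOfSingularities.ResolutionOfSingularities.Theorems.FInjectiveMacaulayfication.CIJacobian

open IsLocalRing Literature.AlgebraicGeometry.Resolution
open Summit.ResolutionOfSingularities.ResolutionOfSingularities.Theorems.FInjectiveMacaulayfication

/-! ## §1 Any ring: `det(Dᵢ fⱼ) ∉ P` ⇒ `(f)R_P` is generated by regular parameters -/

/-- **The mechanism of Matsumura Thm. 30.4 (ii), local form.** For a prime `P` of `R`, derivations `D₁, …, D_r ∈ Der_ℤ(R)`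
and `f₁, …, f_r ∈ P` with `det(Dᵢ fⱼ) ∉ P`: a relation `Σ aⱼ · (fⱼ/1) ∈ 𝔪²` in `R_P` forces all `aⱼ ∈ 𝔪` (clear denominators,
then `forall_mem_of_sum_mul_mem_sq`). [cite: Matsumura1987, Thm. 30.4 (ii) (proof)] -/
-- adapted from Literature/AlgebraicGeometry/Resolution/JacobianRegularLocus.lean (`Matsumura1987_30_4_ii`, Step 1)
theorem forall_mem_maximalIdeal_of_det_not_mem {R : Type} [CommRing R] {r : ℕ} (P : Ideal R) [P.IsPrime]
    (D : Fin r → Derivation ℤ R R) (f : Fin r → R) (hfP : ∀ j, f j ∈ P)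
    (hdet : (Matrix.of fun i j => D i (f j)).det ∉ P) :
    ∀ a : Fin r → Localization.AtPrime P,
      (∑ j, a j * algebraMap R (Localization.AtPrime P) (f j)) ∈ maximalIdeal (Localization.AtPrime P) ^ 2 →
      ∀ j, a j ∈ maximalIdeal (Localization.AtPrime P) := by
  classical
  set A := Localization.AtPrime P with hA
  intro a ha
  -- clear denominators: `b • a j = a' j / 1`
  obtain ⟨b, hb⟩ := IsLocalization.exist_integer_multiples_of_finite P.primeCompl a
  choose a' ha' using hb
  have hsum : algebraMap R A (∑ j, a' j * f j) ∈ (maximalIdeal A) ^ 2 := by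
    have : algebraMap R A (∑ j, a' j * f j) =
        algebraMap R A b * ∑ j, a j * algebraMap R A (f j) := by
      rw [map_sum, Finset.mul_sum]
      refine Finset.sum_congr rfl fun j _ => ?_
      rw [map_mul, ha' j, Algebra.smul_def]
      ring
    rw [this]
    exact Ideal.mul_mem_left _ _ ha
  rw [← Localization.AtPrime.map_eq_maximalIdeal, ← Ideal.map_pow,
    IsLocalization.algebraMap_mem_map_algebraMap_iff P.primeCompl A] at hsum
  obtain ⟨m, hm, hmsum⟩ := hsum
  rw [Finset.mul_sum] at hmsum
  have hb' := forall_mem_of_sum_mul_mem_sq P D f hfP hdet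
    (fun j => m * a' j) (by simpa only [mul_assoc] using hmsum)
  intro j
  have h1 : a' j ∈ P := ((inferInstance : P.IsPrime).mem_or_mem (hb' j)).resolve_left hm
  have h2 : algebraMap R A (a' j) ∈ maximalIdeal A :=
    (IsLocalization.AtPrime.to_map_mem_maximal_iff A P (a' j)).mpr h1
  rw [ha' j, Algebra.smul_def] at h2
  exact (Ideal.unit_mul_mem_iff_mem _ (IsLocalization.map_units A b)).mp h2

/-- **Jacobian criterion for a complete intersection, upstairs** (Matsumura Thm. 30.4 (ii) for the ideal `(f₁, …, f_r)` itself —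
no height hypothesis — combined with Thm. 14.2): if `R_P` is a regular local ring, `fⱼ ∈ P` and `det(Dᵢ fⱼ) ∉ P`, then
`R_P ⧸ (f₁/1, …, f_r/1)` is a regular local ring and `dim R_P⧸(f) + r = dim R_P`.
[cite: Matsumura1987, Thm. 30.4 (ii) and Thm. 14.2] -/
theorem isRegularLocalRing_quotient_of_det_not_mem {R : Type} [CommRing R] {r : ℕ} (P : Ideal R) [P.IsPrime]
    [IsRegularLocalRing (Localization.AtPrime P)]
    (D : Fin r → Derivation ℤ R R) (f : Fin r → R) (hfP : ∀ j, f j ∈ P)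
    (hdet : (Matrix.of fun i j => D i (f j)).det ∉ P) :
    IsRegularLocalRing (Localization.AtPrime P ⧸
        Ideal.span (Set.range fun j => algebraMap R (Localization.AtPrime P) (f j))) ∧
      ringKrullDim (Localization.AtPrime P ⧸
        Ideal.span (Set.range fun j => algebraMap R (Localization.AtPrime P) (f j))) + r =
        ringKrullDim (Localization.AtPrime P) := by
  have hgm : ∀ j, algebraMap R (Localization.AtPrime P) (f j) ∈ maximalIdeal (Localization.AtPrime P) := fun j =>
    (IsLocalization.AtPrime.to_map_mem_maximal_iff (Localization.AtPrime P) P (f j)).mpr (hfP j)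
  exact RegularParameters.isRegularLocalRing_quotient_span_range
    (fun j => algebraMap R (Localization.AtPrime P) (f j)) hgm
    (forall_mem_maximalIdeal_of_det_not_mem P D f hfP hdet)

/-- **Jacobian criterion for a complete intersection at an arbitrary prime, local ring of the quotient**: for a prime `Q` of
`R ⧸ (f₁, …, f_r)` with contraction `P`, if `R_P` is regular and `det(Dᵢ fⱼ) ∉ P` for some `ℤ`-derivations `Dᵢ` of `R`,
then `(R/(f))_Q` is a regular local ring and `dim (R/(f))_Q + r = dim R_P` (transport along `R_P ⧸ (f)R_P ≅ (R/(f))_Q`,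
`CIFedderAtMaximalIdeal.nonempty_quotLocalizationEquiv`). [cite: Matsumura1987, Thm. 30.4 (ii) and Thm. 14.2] -/
theorem isRegularLocalRing_stalk_of_det_not_mem {R : Type} [CommRing R] {r : ℕ} (f : Fin r → R)
    (Q : Ideal (R ⧸ Ideal.span (Set.range f))) [Q.IsPrime]
    [IsRegularLocalRing (Localization.AtPrime (Q.comap (Ideal.Quotient.mk (Ideal.span (Set.range f)))))]
    (D : Fin r → Derivation ℤ R R)
    (hdet : (Matrix.of fun i j => D i (f j)).det ∉ Q.comap (Ideal.Quotient.mk (Ideal.span (Set.range f)))) :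
    IsRegularLocalRing (Localization.AtPrime Q) ∧
      ringKrullDim (Localization.AtPrime Q) + r =
        ringKrullDim (Localization.AtPrime (Q.comap (Ideal.Quotient.mk (Ideal.span (Set.range f))))) := by
  set P : Ideal R := Q.comap (Ideal.Quotient.mk (Ideal.span (Set.range f))) with hP_def
  set A := Localization.AtPrime P
  have hfP : ∀ j, f j ∈ P := fun j => by
    rw [hP_def, Ideal.mem_comap, Ideal.Quotient.eq_zero_iff_mem.mpr (Ideal.subset_span (Set.mem_range_self j))]
    exact Q.zero_mem
  obtain ⟨hreg, hdim⟩ := isRegularLocalRing_quotient_of_det_not_mem P D f hfP hdet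
  have hmap : Ideal.span (Set.range fun j => algebraMap R A (f j)) = (Ideal.span (Set.range f)).map (algebraMap R A) := by
    rw [Ideal.map_span, ← Set.range_comp]
    rfl
  obtain ⟨e₀⟩ := CIFedderAtMaximalIdeal.nonempty_quotLocalizationEquiv R (Ideal.span (Set.range f)) Q
  have e₁ : (A ⧸ Ideal.span (Set.range fun j => algebraMap R A (f j))) ≃+* Localization.AtPrime Q :=
    (Ideal.quotEquivOfEq hmap).trans e₀
  refine ⟨IsRegularLocalRing.of_ringEquiv e₁, ?_⟩
  rw [← ringKrullDim_eq_of_ringEquiv (R := A ⧸ Ideal.span (Set.range fun j => algebraMap R A (f j)))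
    (S := Localization.AtPrime Q) e₁]
  exact hdim

/-! ## §2 The polynomial ring: the clause at a smooth point of a complete intersection -/

section Polynomial

variable (p : ℕ) [Fact p.Prime] (k : Type) [Field k] [CharP k p] (n r : ℕ)

/-- **THE CLAUSE AT A SMOOTH POINT OF A COMPLETE INTERSECTION** (the Khovanskii case of the CI-CN engine, pointwise form):
`S = k[y₀, …, y_{n-1}]`, `f₁, …, f_r ∈ S`, `Q` a prime of `S/(f)` with contraction `P`, and `det(Dᵢ fⱼ) ∉ P` for some
`ℤ`-derivations `Dᵢ` of `S`. Then `(S/(f))_Q` is a regular local ring, a domain, satisfies the per-stalk clause of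
`FrobeniusLadder.FInjectiveMacaulayfication` (every system of parameters weakly regular with Frobenius closed ideal —
`FiClauseOfRegular.stub_fiClauseOfRegular`), and `dim (S/(f))_Q + r = dim S_P`. [cite: Matsumura1987, Thm. 30.4 (ii), Thm. 14.2,
Thm. 14.3, Thm. 17.4] -/
theorem ci_clause_of_det_not_mem (f : Fin r → MvPolynomial (Fin n) k)
    (Q : Ideal (MvPolynomial (Fin n) k ⧸ Ideal.span (Set.range f))) [Q.IsPrime]
    (D : Fin r → Derivation ℤ (MvPolynomial (Fin n) k) (MvPolynomial (Fin n) k))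
    (hdet : (Matrix.of fun i j => D i (f j)).det ∉ Q.comap (Ideal.Quotient.mk (Ideal.span (Set.range f)))) :
    IsRegularLocalRing (Localization.AtPrime Q) ∧ IsDomain (Localization.AtPrime Q) ∧
      (∀ d : ℕ, ringKrullDim (Localization.AtPrime Q) = d → ∀ s : Fin d → Localization.AtPrime Q,
        (Ideal.span (Set.range s)).radical.IsMaximal →
          RingTheory.Sequence.IsWeaklyRegular (Localization.AtPrime Q) (List.ofFn s) ∧
          ∀ y : Localization.AtPrime Q, (∃ e : ℕ, y ^ p ^ e ∈ Ideal.span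
            ((fun z : Localization.AtPrime Q => z ^ p ^ e) ''
              (Ideal.span (Set.range s) : Set (Localization.AtPrime Q)))) → y ∈ Ideal.span (Set.range s)) ∧
      ringKrullDim (Localization.AtPrime Q) + r =
        ringKrullDim (Localization.AtPrime (Q.comap (Ideal.Quotient.mk (Ideal.span (Set.range f))))) := by
  set P : Ideal (MvPolynomial (Fin n) k) := Q.comap (Ideal.Quotient.mk (Ideal.span (Set.range f))) with hP_def
  haveI : IsRegularLocalRing (Localization.AtPrime P) := IsRegularRing.isRegularLocalRing_localization P
  obtain ⟨hreg, hdim⟩ := isRegularLocalRing_stalk_of_det_not_mem f Q D hdet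
  haveI := hreg
  -- characteristic `p` on the local ring of the quotient: transport from `S_P ⧸ (f)`
  set A := Localization.AtPrime P
  have hinj : Function.Injective (algebraMap (MvPolynomial (Fin n) k) A) :=
    IsLocalization.injective A P.primeCompl_le_nonZeroDivisors
  haveI : CharP A p := charP_of_injective_algebraMap hinj p
  have hfP : ∀ j, f j ∈ P := fun j => by
    rw [hP_def, Ideal.mem_comap, Ideal.Quotient.eq_zero_iff_mem.mpr (Ideal.subset_span (Set.mem_range_self j))]
    exact Q.zero_mem
  have hne : (Ideal.span (Set.range f)).map (algebraMap (MvPolynomial (Fin n) k) A) ≠ ⊤ := by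
    intro htop
    have hle : (Ideal.span (Set.range f)).map (algebraMap (MvPolynomial (Fin n) k) A) ≤ maximalIdeal A := by
      rw [Ideal.map_le_iff_le_comap]
      refine Ideal.span_le.mpr ?_
      rintro _ ⟨j, rfl⟩
      exact (IsLocalization.AtPrime.to_map_mem_maximal_iff A P (f j)).mpr (hfP j)
    exact (maximalIdeal.isMaximal A).ne_top (top_le_iff.mp (htop ▸ hle))
  haveI : CharP (A ⧸ (Ideal.span (Set.range f)).map (algebraMap (MvPolynomial (Fin n) k) A)) p :=
    CIChartCore.charP_quotient_of_ne_top p _ hne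
  obtain ⟨e₀⟩ := CIFedderAtMaximalIdeal.nonempty_quotLocalizationEquiv (MvPolynomial (Fin n) k)
    (Ideal.span (Set.range f)) Q
  haveI : CharP (Localization.AtPrime Q) p := charP_of_injective_ringHom (f := e₀.toRingHom) e₀.injective p
  obtain ⟨hdom, hcl⟩ := FiClauseOfRegular.stub_fiClauseOfRegular p (Localization.AtPrime Q)
  exact ⟨hreg, hdom, hcl, hdim⟩

/-- The same at a MAXIMAL ideal `Q` (a closed point): `dim (S/(f))_Q + r = n` — the expected-dimension binder of
`CIFedderAtMaximalIdeal.ci_fedderAtMaximalIdeal` / `CIChartClause.ciChartClause`. [cite: Matsumura1987, §5 Ex. 5.1] -/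
theorem ringKrullDim_stalk_add_eq_of_det_not_mem (f : Fin r → MvPolynomial (Fin n) k)
    (Q : Ideal (MvPolynomial (Fin n) k ⧸ Ideal.span (Set.range f))) [Q.IsMaximal]
    (D : Fin r → Derivation ℤ (MvPolynomial (Fin n) k) (MvPolynomial (Fin n) k))
    (hdet : (Matrix.of fun i j => D i (f j)).det ∉ Q.comap (Ideal.Quotient.mk (Ideal.span (Set.range f)))) :
    ringKrullDim (Localization.AtPrime Q) + (r : WithBot ℕ∞) = (n : WithBot ℕ∞) := by
  haveI hPmax : (Q.comap (Ideal.Quotient.mk (Ideal.span (Set.range f)))).IsMaximal :=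
    Ideal.comap_isMaximal_of_surjective _ Ideal.Quotient.mk_surjective
  haveI : IsRegularLocalRing (Localization.AtPrime (Q.comap (Ideal.Quotient.mk (Ideal.span (Set.range f))))) :=
    IsRegularRing.isRegularLocalRing_localization _
  obtain ⟨-, hdim⟩ := isRegularLocalRing_stalk_of_det_not_mem f Q D hdet
  rw [IsLocalization.AtPrime.ringKrullDim_eq_height (Q.comap (Ideal.Quotient.mk (Ideal.span (Set.range f))))
    (Localization.AtPrime (Q.comap (Ideal.Quotient.mk (Ideal.span (Set.range f))))),
    MvPolynomial.height_eq_of_isMaximal k n] at hdim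
  exact hdim

end Polynomial

/-! ## §3 The chart-uniform Jacobian certificate -/

/-- **CI JACOBIAN CERTIFICATE, CHART-UNIFORM FORM** (the one-call theorem a SMOOTH chart of the CI-CN engine consumes): for
`S = k[y₀, …, y_{n-1}]`, `f₁, …, f_r`, an ideal `B` (e.g. the exceptional coordinates of the chart) and finitely many choices
`js μ : Fin r → Fin n` of coordinate directions, a Bezout identity `1 ∈ (f) + B + (det (∂ fⱼ / ∂ y_{js μ i}))_μ` certifies, at
EVERY prime `Q ⊇ B` of `S/(f)`: `(S/(f))_Q` is regular, a domain, satisfies the per-stalk clause of the crux, and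
`dim (S/(f))_Q + r = dim S_{Q ∩ S}` (`= n` at closed points). [cite: Matsumura1987, Thm. 30.4 (ii), Thm. 14.2] -/
theorem ci_clause_of_jacobianCertificate : ∀ (p : ℕ) [Fact p.Prime] (k : Type) [Field k] [CharP k p] (n r t : ℕ)
    (f : Fin r → MvPolynomial (Fin n) k) (B : Ideal (MvPolynomial (Fin n) k)) (js : Fin t → Fin r → Fin n),
    (1 : MvPolynomial (Fin n) k) ∈ Ideal.span (Set.range f) ⊔ B ⊔
      Ideal.span (Set.range fun μ : Fin t =>
        (Matrix.of fun i j => MvPolynomial.pderiv (js μ i) (f j)).det) →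
    ∀ (Q : Ideal (MvPolynomial (Fin n) k ⧸ Ideal.span (Set.range f))) [Q.IsPrime],
    B.map (Ideal.Quotient.mk (Ideal.span (Set.range f))) ≤ Q →
    IsRegularLocalRing (Localization.AtPrime Q) ∧ IsDomain (Localization.AtPrime Q) ∧
      (∀ d : ℕ, ringKrullDim (Localization.AtPrime Q) = d → ∀ s : Fin d → Localization.AtPrime Q,
        (Ideal.span (Set.range s)).radical.IsMaximal →
          RingTheory.Sequence.IsWeaklyRegular (Localization.AtPrime Q) (List.ofFn s) ∧
          ∀ y : Localization.AtPrime Q, (∃ e : ℕ, y ^ p ^ e ∈ Ideal.span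
            ((fun z : Localization.AtPrime Q => z ^ p ^ e) ''
              (Ideal.span (Set.range s) : Set (Localization.AtPrime Q)))) → y ∈ Ideal.span (Set.range s)) ∧
      ringKrullDim (Localization.AtPrime Q) + r =
        ringKrullDim (Localization.AtPrime (Q.comap (Ideal.Quotient.mk (Ideal.span (Set.range f))))) := by
  intro p _ k _ _ n r t f B js hcert Q _ hBQ
  set P : Ideal (MvPolynomial (Fin n) k) := Q.comap (Ideal.Quotient.mk (Ideal.span (Set.range f))) with hP_def
  -- some minor lies outside `P` (else `1 ∈ P`)
  have hfP : Ideal.span (Set.range f) ≤ P := by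
    refine Ideal.span_le.mpr ?_
    rintro _ ⟨j, rfl⟩
    rw [SetLike.mem_coe, hP_def, Ideal.mem_comap,
      Ideal.Quotient.eq_zero_iff_mem.mpr (Ideal.subset_span (Set.mem_range_self j))]
    exact Q.zero_mem
  have hBP : B ≤ P := by
    intro b hb
    rw [hP_def, Ideal.mem_comap]
    exact hBQ (Ideal.mem_map_of_mem _ hb)
  have hex : ∃ μ : Fin t, (Matrix.of fun i j => MvPolynomial.pderiv (js μ i) (f j)).det ∉ P := by
    by_contra hall
    have hall' : ∀ μ : Fin t, (Matrix.of fun i j => MvPolynomial.pderiv (js μ i) (f j)).det ∈ P :=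
      fun μ => not_not.mp (not_exists.mp hall μ)
    have hle : Ideal.span (Set.range f) ⊔ B ⊔ Ideal.span (Set.range fun μ : Fin t =>
        (Matrix.of fun i j => MvPolynomial.pderiv (js μ i) (f j)).det) ≤ P := by
      refine sup_le (sup_le hfP hBP) (Ideal.span_le.mpr ?_)
      rintro _ ⟨μ, rfl⟩
      exact hall' μ
    exact (inferInstance : P.IsPrime).ne_top (P.eq_top_iff_one.mpr (hle hcert))
  obtain ⟨μ, hμ⟩ := hex
  have h := ci_clause_of_det_not_mem p k n r f Q (fun i => (MvPolynomial.pderiv (js μ i)).restrictScalars ℤ)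
    (by simpa only [Derivation.restrictScalars_apply] using hμ)
  exact h

end Summit.ResolutionOfSingularities.ResolutionOfSingularities.Theorems.FInjectiveMacaulayfication.CIJacobian

end
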